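import Summits.Ventures.HSemireg.WedgeModel

/-!
# Venture HSemireg — the wedge model: coordinates of products, independence of products, one fresh pair

HONEST FRAMING. Part of the Lean index of the computation cell `pub-hsemireg` (seat p3; Sunday enclosure of the
FORMULA-N kernel assets of seats th-7 / th-6, ENCLOSURE-PLAN-p3.md).  Finite-dimensional exterior algebra over a field ONLY:
no variety, no cohomology theory, no semiregularity map is constructed here; nothing here says that HC / HC_CM / HC_AV holds;
no Literature fact is declared or used.  The geometric DICTIONARY (why these ranks are the `HT`-side box ranks of the cell's
STRUCTURE.md §1 / theory/FORMULA-N.md) lives in theory/FORMULA-N-th7.md PART B §A.3 / §N and is NOT asserted in Lean.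

Second infrastructure file of the wedge model (th-7 KunnethRank.lean l.206–353 + HankelRank.lean l.291–362): coordinates of a
product of block-supported elements (`coord_mul`: at `s₁ ⊔ s₂` the coordinate of `v ∧ w` is `u(s₁,s₂) · v_{s₁} · w_{s₂}`), the KEY
linear-independence theorem `linearIndependent_mul` (products of independent homogeneous families on disjoint blocks are independent —
read off coordinates, dividing pointwise by the unit `u`), injectivity of multiplication by a disjoint monomial, and the sign-free
«fresh pair» lemma `triple_eq_zero` (`p x + q y + r (x y) = 0 ⇒ p = q = r = 0` for `p q r ∈ Alg D`, `x, y ∉ D`) that drives the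
Hankel induction.  th-7's statements and proofs, unchanged.
-/

open Module Set Set.powersetCard

namespace Summit.Ventures.HSemireg.Wedge

variable (K : Type*) [Field K] {I : Type*} [LinearOrder I] [Fintype I]

omit [Fintype I] in
/-- for disjoint blocks, `a ∪ c = s₁ ∪ s₂` with `a, s₁ ⊆ D₁`, `c, s₂ ⊆ D₂` iff `a = s₁` and `c = s₂`. -/
lemma union_eq_union_iff {D₁ D₂ a c s₁ s₂ : Finset I} (hD : Disjoint D₁ D₂) (ha : a ⊆ D₁) (hc : c ⊆ D₂)
    (h₁ : s₁ ⊆ D₁) (h₂ : s₂ ⊆ D₂) : a ∪ c = s₁ ∪ s₂ ↔ a = s₁ ∧ c = s₂ := by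
  constructor
  · intro h
    have k1 : ∀ {x y : Finset I}, x ⊆ D₁ → y ⊆ D₂ → (x ∪ y) ∩ D₁ = x := by
      intro x y hx hy
      ext i
      simp only [Finset.mem_inter, Finset.mem_union]
      constructor
      · rintro ⟨h' | h', hi⟩
        · exact h'
        · exact (Finset.disjoint_left.mp hD hi (hy h')).elim
      · intro hi; exact ⟨Or.inl hi, hx hi⟩
    have k2 : ∀ {x y : Finset I}, x ⊆ D₁ → y ⊆ D₂ → (x ∪ y) ∩ D₂ = y := by
      intro x y hx hy
      ext i
      simp only [Finset.mem_inter, Finset.mem_union]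
      constructor
      · rintro ⟨h' | h', hi⟩
        · exact (Finset.disjoint_left.mp hD (hx h') hi).elim
        · exact h'
      · intro hi; exact ⟨Or.inr hi, hy hi⟩
    constructor
    · rw [← k1 ha hc, h, k1 h₁ h₂]
    · rw [← k2 ha hc, h, k2 h₁ h₂]
  · rintro ⟨rfl, rfl⟩; rfl

/-- coordinate of a product `v ∧ w`, `v ∈ Alg D₁`, `w ∈ Alg D₂`, at `s₁ ⊔ s₂`:
`u(s₁,s₂) · v_{s₁} · w_{s₂}` — the structure constant is a unit, its value irrelevant. -/
lemma coord_mul {D₁ D₂ : Finset I} (hD : Disjoint D₁ D₂) {v w : HT K I} (hv : v ∈ Alg K I D₁)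
    (hw : w ∈ Alg K I D₂) {s₁ s₂ : Finset I} (h₁ : s₁ ⊆ D₁) (h₂ : s₂ ⊆ D₂) :
    (B K I).coord (s₁ ∪ s₂) (v * w) = u K s₁ s₂ * (B K I).coord s₁ v * (B K I).coord s₂ w := by
  classical
  induction hv, hw using Submodule.span_induction₂ with
  | mem_mem x y hx hy =>
    obtain ⟨a, ha, rfl⟩ := hx
    obtain ⟨c, hc, rfl⟩ := hy
    rw [B_mul_B, map_smul, smul_eq_mul]
    simp only [Basis.coord_apply, Basis.repr_self, Finsupp.single_apply]
    by_cases hac : a = s₁ ∧ c = s₂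
    · obtain ⟨rfl, rfl⟩ := hac
      simp
    · rw [if_neg (fun h => hac ((union_eq_union_iff hD ha hc h₁ h₂).mp h)), mul_zero]
      by_cases ha' : a = s₁
      · subst ha'
        rw [if_pos rfl, if_neg (fun h => hac ⟨rfl, h⟩), mul_zero]
      · rw [if_neg ha', mul_zero, zero_mul]
  | zero_left y _ => simp
  | zero_right x _ => simp
  | add_left x y z _ _ _ hx hy => rw [add_mul, map_add, hx, hy, map_add]; ring
  | add_right x y z _ _ _ hx hy => rw [mul_add, map_add, hx, hy, map_add]; ring
  | smul_left r x y _ _ hx => rw [smul_mul_assoc, map_smul, hx, map_smul, smul_eq_mul, smul_eq_mul]; ring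
  | smul_right r x y _ _ hx => rw [mul_smul_comm, map_smul, hx, map_smul, smul_eq_mul, smul_eq_mul]; ring

/-! ### Linear independence of products of block-supported homogeneous families -/

omit [LinearOrder I] [Fintype I] in
/-- subsets of disjoint blocks are disjoint. -/
lemma disjoint_of_subsets {D₁ D₂ s₁ s₂ : Finset I} (hD : Disjoint D₁ D₂) (h₁ : s₁ ⊆ D₁) (h₂ : s₂ ⊆ D₂) :
    Disjoint s₁ s₂ :=
  Finset.disjoint_of_subset_left h₁ (Finset.disjoint_of_subset_right h₂ hD)

omit [LinearOrder I] [Fintype I] in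
/-- a finite combination of elements of a submodule is in it (helper). -/
lemma sum_smul_mem' {P : Submodule K (HT K I)} {γ : Type*} [Fintype γ] (c : γ → K) (x : γ → HT K I)
    (hx : ∀ j, x j ∈ P) : ∑ j, c j • x j ∈ P :=
  Submodule.sum_mem _ fun j _ => Submodule.smul_mem _ _ (hx j)

/-- KEY: products of linearly independent homogeneous families supported on disjoint blocks, with the
bidegree determined by the index `i` (via an injective degree function `e₁`), are linearly independent. -/
theorem linearIndependent_mul {D₁ D₂ : Finset I} (hD : Disjoint D₁ D₂) {m : ℕ} (e₁ e₂ : Fin m → ℕ)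
    (he₁ : Function.Injective e₁)
    {ι κ : Fin m → Type*} [∀ i, Fintype (ι i)] [∀ i, Fintype (κ i)]
    (v : (i : Fin m) → ι i → HT K I) (w : (i : Fin m) → κ i → HT K I)
    (hv : ∀ i α, v i α ∈ Hom K I D₁ (e₁ i)) (hw : ∀ i β, w i β ∈ Hom K I D₂ (e₂ i))
    (hvli : ∀ i, LinearIndependent K (v i)) (hwli : ∀ i, LinearIndependent K (w i)) :
    LinearIndependent K (fun x : (Σ i, ι i × κ i) => v x.1 x.2.1 * w x.1 x.2.2) := by
  classical
  rw [Fintype.linearIndependent_iff]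
  intro g hg
  -- Step 1: for every i₀, s₁ ⊆ D₁ of the right size and s₂ ⊆ D₂, the (s₁,s₂)-coefficient identity
  have step1 : ∀ (i₀ : Fin m) (s₁ : Finset I), s₁ ⊆ D₁ → s₁.card = e₁ i₀ → ∀ s₂ : Finset I, s₂ ⊆ D₂ →
      ∑ α, ∑ β, g ⟨i₀, (α, β)⟩ * ((B K I).coord s₁ (v i₀ α) * (B K I).coord s₂ (w i₀ β)) = 0 := by
    intro i₀ s₁ hs₁ hc₁ s₂ hs₂
    have h0 := congr_arg ((B K I).coord (s₁ ∪ s₂)) hg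
    rw [map_zero, map_sum, Fintype.sum_sigma] at h0
    simp_rw [map_smul, smul_eq_mul, Fintype.sum_prod_type] at h0
    have hsplit : (∑ i, ∑ α, ∑ β, g ⟨i, (α, β)⟩ * (B K I).coord (s₁ ∪ s₂) (v i α * w i β)) =
        ∑ α, ∑ β, g ⟨i₀, (α, β)⟩ * (B K I).coord (s₁ ∪ s₂) (v i₀ α * w i₀ β) := by
      apply Finset.sum_eq_single_of_mem i₀ (Finset.mem_univ _)
      intro i _ hi
      apply Finset.sum_eq_zero; intro α _
      apply Finset.sum_eq_zero; intro β _
      rw [coord_mul K hD (Hom_le_Alg K D₁ _ (hv i α)) (Hom_le_Alg K D₂ _ (hw i β)) hs₁ hs₂,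
        coord_eq_zero_of_mem_Hom K (hv i α) (t := s₁) ?_]
      · ring
      · rintro ⟨-, hc⟩
        exact hi (he₁ (by rw [← hc, hc₁]))
    rw [hsplit] at h0
    have hfac : (∑ α, ∑ β, g ⟨i₀, (α, β)⟩ * (B K I).coord (s₁ ∪ s₂) (v i₀ α * w i₀ β)) =
        u K s₁ s₂ * ∑ α, ∑ β, g ⟨i₀, (α, β)⟩ * ((B K I).coord s₁ (v i₀ α) * (B K I).coord s₂ (w i₀ β)) := by
      rw [Finset.mul_sum]
      refine Finset.sum_congr rfl fun α _ => ?_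
      rw [Finset.mul_sum]
      refine Finset.sum_congr rfl fun β _ => ?_
      rw [coord_mul K hD (Hom_le_Alg K D₁ _ (hv i₀ α)) (Hom_le_Alg K D₂ _ (hw i₀ β)) hs₁ hs₂]
      ring
    rw [hfac] at h0
    exact (mul_eq_zero.mp h0).resolve_left ((u_ne_zero_iff K).mpr (disjoint_of_subsets hD hs₁ hs₂))
  -- Step 2: for every i₀ and s₁ ⊆ D₁, the inner coefficients vanish
  have step2 : ∀ (i₀ : Fin m) (β : κ i₀) (s₁ : Finset I), s₁ ⊆ D₁ →
      ∑ α, g ⟨i₀, (α, β)⟩ * (B K I).coord s₁ (v i₀ α) = 0 := by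
    intro i₀ β s₁ hs₁
    by_cases hc₁ : s₁.card = e₁ i₀
    · -- the element W := Σ_β c_β • w i₀ β of Alg D₂ has all D₂-coordinates zero
      set c : κ i₀ → K := fun β => ∑ α, g ⟨i₀, (α, β)⟩ * (B K I).coord s₁ (v i₀ α) with hc
      have hW : ∑ β, c β • w i₀ β = 0 := by
        apply eq_zero_of_coord_eq_zero K (D := D₂)
        · exact sum_smul_mem' K c _ fun β => Hom_le_Alg K D₂ _ (hw i₀ β)
        · intro s₂ hs₂
          rw [map_sum]
          simp_rw [map_smul, smul_eq_mul, hc, Finset.sum_mul]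
          rw [Finset.sum_comm]
          have := step1 i₀ s₁ hs₁ hc₁ s₂ hs₂
          rw [← this]
          refine Finset.sum_congr rfl fun α _ => Finset.sum_congr rfl fun β _ => ?_
          ring
      have := (Fintype.linearIndependent_iff.mp (hwli i₀)) c hW β
      rw [hc] at this
      exact this
    · apply Finset.sum_eq_zero
      intro α _
      rw [coord_eq_zero_of_mem_Hom K (hv i₀ α) (t := s₁) (fun h => hc₁ h.2), mul_zero]
  -- Step 3: conclude with the independence of the v's
  rintro ⟨i₀, α₀, β₀⟩
  set c : ι i₀ → K := fun α => g ⟨i₀, (α, β₀)⟩ with hc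
  have hV : ∑ α, c α • v i₀ α = 0 := by
    apply eq_zero_of_coord_eq_zero K (D := D₁)
    · exact sum_smul_mem' K c _ fun α => Hom_le_Alg K D₁ _ (hv i₀ α)
    · intro s₁ hs₁
      rw [map_sum]
      simp_rw [map_smul, smul_eq_mul, hc]
      exact step2 i₀ β₀ s₁ hs₁
  have := (Fintype.linearIndependent_iff.mp (hvli i₀)) c hV α₀
  rw [hc] at this
  exact this

/-- multiplication by a monomial `E_t` with `t ∩ D = ∅` is injective on `Alg D`. -/
lemma eq_zero_of_mul_B_eq_zero {D t : Finset I} (hDt : Disjoint D t) {w : HT K I} (hw : w ∈ Alg K I D)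
    (h : w * B K I t = 0) : w = 0 := by
  classical
  apply eq_zero_of_coord_eq_zero K hw
  intro s hs
  have hc := coord_mul K hDt hw (B_mem_Alg K (subset_refl t)) hs (subset_refl t)
  have h1 : (B K I).coord t (B K I t) = 1 := by
    rw [Basis.coord_apply, Basis.repr_self, Finsupp.single_eq_same]
  rw [h, map_zero, h1, mul_one] at hc
  have hu : u K s t ≠ 0 :=
    (u_ne_zero_iff K).mpr (Finset.disjoint_of_subset_left hs hDt)
  exact (mul_eq_zero.mp hc.symm).resolve_left hu

/-! ### One pair of fresh generators -/

/-- a generator as a monomial. -/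
noncomputable abbrev gx (i : I) : HT K I := B K I {i}

/-- a generator squares to zero. -/
lemma gx_mul_self (i : I) : gx K i * gx K i = 0 := by
  rw [gx, B_mul_B, u_eq_zero K (by simp), zero_smul]

/-- two generators anticommute. -/
lemma gy_mul_gx (i j : I) : gx K j * gx K i = -(gx K i * gx K j) := by
  rw [gx, gx, B_mul_B_comm, Finset.card_singleton, Finset.card_singleton, mul_one, pow_one, neg_one_smul]

/-- `x (y x) = 0` for generators `x`, `y`. -/
lemma gx_gy_gx (i j : I) : gx K i * (gx K j * gx K i) = 0 := by
  rw [gy_mul_gx K, mul_neg, ← mul_assoc, gx_mul_self, zero_mul, neg_zero]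

/-- the product of two generators is a structure constant times the pair monomial. -/
lemma gx_mul_gy (i j : I) : gx K i * gx K j = u K {i} {j} • B K I {i, j} := by
  rw [gx, gx, B_mul_B, Finset.insert_eq]

omit [Fintype I] in
/-- the structure constant of two distinct generators is non-zero. -/
lemma u_pair_ne_zero {i j : I} (hij : i ≠ j) : u K ({i} : Finset I) {j} ≠ 0 :=
  (u_ne_zero_iff K).mpr (Finset.disjoint_singleton.mpr hij)

/-- `w ∈ Alg D`, `w · (x y) = 0` ⇒ `w = 0` (for fresh `i ≠ j`). -/
lemma eq_zero_of_mul_xy {D : Finset I} {i j : I} (hi : i ∉ D) (hj : j ∉ D) (hij : i ≠ j)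
    {w : HT K I} (hw : w ∈ Alg K I D) (h : w * (gx K i * gx K j) = 0) : w = 0 := by
  rw [gx_mul_gy K, mul_smul_comm, smul_eq_zero] at h
  rcases h with h | h
  · exact (u_pair_ne_zero K hij h).elim
  · apply eq_zero_of_mul_B_eq_zero K (D := D) (t := {i, j}) _ hw h
    rw [Finset.disjoint_insert_right, Finset.disjoint_singleton_right]
    exact ⟨hi, hj⟩

/-- `w ∈ Alg D`, `w · x = 0` for a fresh generator `x ∉ D` ⇒ `w = 0`. -/
lemma eq_zero_of_mul_x {D : Finset I} {i : I} (hi : i ∉ D) {w : HT K I} (hw : w ∈ Alg K I D)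
    (h : w * gx K i = 0) : w = 0 :=
  eq_zero_of_mul_B_eq_zero K (Finset.disjoint_singleton_right.mpr hi) hw h

/-- KEY (sign-free independence): for `p q r ∈ Alg D` and fresh `i ≠ j`,
`p x + q y + r (x y) = 0` forces `p = q = r = 0`. -/
lemma triple_eq_zero {D : Finset I} {i j : I} (hi : i ∉ D) (hj : j ∉ D) (hij : i ≠ j)
    {p q r : HT K I} (hp : p ∈ Alg K I D) (hq : q ∈ Alg K I D) (hr : r ∈ Alg K I D)
    (h : p * gx K i + q * gx K j + r * (gx K i * gx K j) = 0) : p = 0 ∧ q = 0 ∧ r = 0 := by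
  -- multiply by y on the right: p (x y) = 0
  have h1 : p * (gx K i * gx K j) = 0 := by
    have := congr_arg (· * gx K j) h
    simpa only [add_mul, zero_mul, mul_assoc, gx_mul_self, mul_zero, add_zero] using this
  have hp0 : p = 0 := eq_zero_of_mul_xy K hi hj hij hp h1
  subst hp0
  rw [zero_mul, zero_add] at h
  -- multiply by x on the right: q y x = - q x y = 0
  have h2 : q * (gx K i * gx K j) = 0 := by
    have := congr_arg (· * gx K i) h
    simp only [add_mul, zero_mul, mul_assoc, gx_gy_gx K, mul_zero, add_zero] at this
    rwa [gy_mul_gx K, mul_neg, neg_eq_zero] at this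
  have hq0 : q = 0 := eq_zero_of_mul_xy K hi hj hij hq h2
  subst hq0
  rw [zero_mul, zero_add] at h
  exact ⟨rfl, rfl, eq_zero_of_mul_xy K hi hj hij hr h⟩

/-! ### Tuple maps -/

end Summit.Ventures.HSemireg.Wedge
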